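import Summits.QuantumAdvantage.QuantumAdvantage.Theses.WhiteBoxWalk
import Literature.Computability.QuantumComplexity.GluedTrees
import Literature.Computability.Cryptography.OracleGames

/-!
# Sketch — crux-ideate stmt-QuantumAdvantage-2238 (`WbwThesis`), ideator 2, round 1

First lemmas of the three idea cards (they must ELABORATE; proofs are not required here):

* §A `weak-bit-direct-product`: `WeakPlanted → WbwThesis` (CHS05 direct product for weakly
  verifiable puzzles + coordinatewise-majority amplification of a pseudo-deterministic family).
* §B `planted-peak-mode`: the (Q) side for circuit-description instances — a universal
  Clifford+T interpreter family that outputs the peak of a 3/4-peaked described circuit with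
  probability ≥ 2/3 (mode finding), and the shape of the load-bearing conjecture `WeakPeakHiding`.
* §C `predicate-vbb-bitwise`: classical predicate-VBB of a seed-indexed code family w.r.t.
  seed-indexed oracles + a black-box traversal bound ⇒ WEAK classical hardness (which §A
  then amplifies). Plus the horizon lemma over the tree's `GluedTrees` vocabulary.
-/

noncomputable section

namespace Summit.QuantumAdvantage.QuantumAdvantage.Cruxes.WbwThesis.Sketch

open Filter Asymptotics
open _root_.Computability Literature.Computability.Complexity Literature.Computability.Cryptography
open Literature.Computability.QuantumComplexity
open Summit.QuantumAdvantage.QuantumAdvantage.Theses.WhiteBoxWalk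

/-! ### §A weak-bit-direct-product -/

/-- The classical success functional of `WbwThesis`, clause (C): average over seeds `s ∈ {0,1}ⁿ`
of the probability that `A(1ⁿ, gen s)` outputs a string with prefix `ans s`. -/
def succ (gen ans : List Bool → List Bool) (A : RandAlg (List Bool) (List Bool)) (n : ℕ) : ℝ :=
  uniformAvg n fun s => A.pr id (boolPair (unaryEncodeNat n) (gen s)) {y | ans s <+: y}

/-- Clause (Q) of `WbwThesis` for a pair `(gen, ans)`. -/
def QClause (gen ans : List Bool → List Bool) : Prop :=
  ∃ F : QCircuitFamily cliffordT, F.IsOracleFree ∧ F.IsUniform ∧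
    ∀ s, 2 / 3 ≤ F.kernelProb 0 (gen s) {y | ans s <+: y}

/-- `C⁺ = WeakPlanted`: a WEAK planted advantage with SEED-COMPUTABLE answers and length-regular
shape: `gen, ans ∈ FP` (so the seed holder can verify a candidate answer — a *weakly verifiable
puzzle* in the sense of Canetti–Halevi–Steiner 2005), `|gen s| = ℓ(|s|)`, `|ans s| = p(|s|)`,
clause (Q) as in `WbwThesis`, and (C_weak): for SOME polynomial `q`, every PPT solver eventually
succeeds with probability at most `1 - 1/(q(n)+1)` (noticeable failure, not negligible success). -/
def WeakPlanted : Prop :=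
  ∃ (gen ans : List Bool → List Bool) (ℓ p q : Polynomial ℕ),
    PolyTimeComputable (id : List Bool → List Bool) (id : List Bool → List Bool) gen ∧
    PolyTimeComputable (id : List Bool → List Bool) (id : List Bool → List Bool) ans ∧
    (∀ s, (gen s).length = ℓ.eval s.length) ∧ (∀ s, (ans s).length = p.eval s.length) ∧
    QClause gen ans ∧
    ∀ A : RandAlg (List Bool) (List Bool), IsPPT A id →
      ∀ᶠ n in atTop, succ gen ans A n ≤ 1 - 1 / (((q.eval n : ℕ) : ℝ) + 1)

/-- **First lemma of card `weak-bit-direct-product` (the transfer `C⁺ → X`).** Direct product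
`gen⃗(s₁⋯s_k) = (gen s₁,…,gen s_k)`, `ans⃗ = ans s₁ ++ ⋯ ++ ans s_k` with `k = n·(q n + 1)`:
classical success of the product is superpolynomially small by the Canetti–Halevi–Steiner
hardness-amplification theorem for weakly verifiable puzzles (the verifier is `s ↦ ans s ∈ FP`);
quantum success stays `≥ 2/3` for EVERY seed tuple by `O(log k)`-fold coordinatewise majority of
the pseudo-deterministic family of `QClause`; lengths are re-padded so that `|ans⃗| = p'(|gen⃗|)`. -/
theorem weakPlanted_to_wbwThesis : WeakPlanted → WbwThesis := by
  sorry

/-- The one-bit normal form `C⁺₁`: a planted DECISION advantage — the answer is a single bit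
`b s`, quantumly decided on every instance, classically mispredicted with probability
`≥ 1/(q n + 1)` eventually. (Special case `p = 1` of `WeakPlanted`; recorded because every known
engine produces this shape natively.) -/
def WeakPlantedBit : Prop :=
  ∃ (gen : List Bool → List Bool) (b : List Bool → Bool) (ℓ q : Polynomial ℕ),
    PolyTimeComputable (id : List Bool → List Bool) (id : List Bool → List Bool) gen ∧
    PolyTimeComputable (id : List Bool → List Bool) (id : List Bool → List Bool) (fun s => [b s]) ∧
    (∀ s, (gen s).length = ℓ.eval s.length) ∧
    QClause gen (fun s => [b s]) ∧
    ∀ A : RandAlg (List Bool) (List Bool), IsPPT A id →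
      ∀ᶠ n in atTop, succ gen (fun s => [b s]) A n ≤ 1 - 1 / (((q.eval n : ℕ) : ℝ) + 1)

/-- `C⁺₁ → C⁺` (definitional repackaging with `p = 1`). -/
theorem weakPlantedBit_to_weakPlanted : WeakPlantedBit → WeakPlanted := by
  rintro ⟨gen, b, ℓ, q, hgen, hb, hℓ, hQ, hC⟩
  exact ⟨gen, fun s => [b s], ℓ, 1, q, hgen, hb, hℓ, fun s => by simp, hQ, hC⟩

/-! ### §B planted-peak-mode -/

/-- The Born weight that the described circuit `C` (no input wires, `m` work wires, run on
`|0^m⟩`, all wires measured) puts on outcomes with prefix `a`: "`C` is `δ`-peaked at `a`" iff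
this is `≥ δ` (Aaronson–Zhang 2024, `p_max`; here per prefix). -/
def peakWeight (m : ℕ) (C : QCircuit cliffordT (0 + m)) (a : List Bool) : ℝ :=
  (((C.outputPMF 0 (fun i => i.elim0)).map List.ofFn).toOuterMeasure {y | a <+: y}).toReal

/-- **First lemma of card `planted-peak-mode` (the (Q) side, assumption-free).** A universal
Clifford+T INTERPRETER-WITH-MAJORITY family: on input the code `sigmaEncode ⟨0, m, C⟩` of an
oracle-free circuit that is `3/4`-peaked at `a`, it outputs (a string with prefix) `a` with
probability `≥ 2/3` — run `t = O(log |a|)` coherent copies of `C` (controlled-gate interpreter,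
exact Clifford+T synthesis of controlled `H`, `T`, `CNOT`) and write the coordinatewise majority on
the leading wires. This is what makes a planted peak a PSEUDO-DETERMINISTIC answer for EVERY
instance (no canonization problem: the mode is unique once the peak weight exceeds `1/2`). -/
theorem interpreter_mode :
    ∃ F : QCircuitFamily cliffordT, F.IsOracleFree ∧ F.IsUniform ∧
      ∀ (m : ℕ) (C : QCircuit cliffordT (0 + m)) (a : List Bool), C.IsOracleFree →
        (3 : ℝ) / 4 ≤ peakWeight m C a →
          2 / 3 ≤ F.kernelProb 0 (QCircuit.sigmaEncode (G := cliffordT) ⟨0, m, C⟩) {y | a <+: y} := by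
  sorry

/-- A PEAK PLANTER: a deterministic poly-time map from seeds to (described circuit, planted peak)
such that every output circuit is `3/4`-peaked at its planted string (the generator KNOWS the
answer by construction — e.g. scrambled `T[C] ▷ T'[C†] ▷ X^a` compilations). -/
structure PeakPlanter where
  /-- work wires -/
  wires : List Bool → ℕ
  /-- the described circuit -/
  circ : ∀ s : List Bool, QCircuit cliffordT (0 + wires s)
  /-- the planted peak -/
  peak : List Bool → List Bool
  oracleFree : ∀ s, (circ s).IsOracleFree
  peaked : ∀ s, (3 : ℝ) / 4 ≤ peakWeight (wires s) (circ s) (peak s)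
  genFP : PolyTimeComputable (id : List Bool → List Bool) (id : List Bool → List Bool)
    fun s => QCircuit.sigmaEncode (G := cliffordT) ⟨0, wires s, circ s⟩
  peakFP : PolyTimeComputable (id : List Bool → List Bool) (id : List Bool → List Bool) peak
  lengthRegular : ∃ ℓ p : Polynomial ℕ, (∀ s, (QCircuit.sigmaEncode (G := cliffordT)
    ⟨0, wires s, circ s⟩).length = ℓ.eval s.length) ∧ ∀ s, (peak s).length = p.eval s.length

/-- The load-bearing conjecture of the card, in WEAK form (thanks to §A): `WeakPeakHiding P` —
for some polynomial `q`, no PPT, given `(1ⁿ, code of P.circ s)` for uniform `s ∈ {0,1}ⁿ`, outputs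
the planted peak with probability more than `1 - 1/(q n + 1)`, eventually. Quantumly FALSE by
`interpreter_mode` (as the §A quantum-shadow theorem of crux 2340 demands of any usable
hypothesis); classically a "compiled-quantum-circuit one-wayness" statement (Aaronson–Zhang 2024;
Zhang 2025 §3.3 "compiler as obfuscator"; Gharibyan et al. 2025). -/
def WeakPeakHiding (P : PeakPlanter) : Prop :=
  ∃ q : Polynomial ℕ, ∀ A : RandAlg (List Bool) (List Bool), IsPPT A id →
    ∀ᶠ n in atTop,
      succ (fun s => QCircuit.sigmaEncode (G := cliffordT) ⟨0, P.wires s, P.circ s⟩) P.peak A n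
        ≤ 1 - 1 / (((q.eval n : ℕ) : ℝ) + 1)

/-- Composition of the card: a weakly hiding peak planter gives `C⁺` (by `interpreter_mode`),
hence `X` (by §A). -/
theorem wbwThesis_of_peakPlanter (P : PeakPlanter) (h : WeakPeakHiding P) : WbwThesis := by
  refine weakPlanted_to_wbwThesis ?_
  obtain ⟨ℓ, p, hℓ, hp⟩ := P.lengthRegular
  obtain ⟨q, hq⟩ := h
  obtain ⟨F, hF, hU, hrun⟩ := interpreter_mode
  exact ⟨_, P.peak, ℓ, p, q, P.genFP, P.peakFP, hℓ, hp,
    ⟨F, hF, hU, fun s => hrun _ _ _ (P.oracleFree s) (P.peaked s)⟩, hq⟩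

/-! ### §C predicate-vbb-bitwise -/

/-- A seed-indexed WHITE-BOX/BLACK-BOX pair: `code s` is the law of the published instance string
(e.g. `(iO(N_k; r), name_k(ENTRANCE))` over the obfuscator's coins, `k` derived from `s`), and
`orc s` is the oracle that the same instance presents as a black box (e.g.
`GluedTrees.strOracle σ_k ν_k`), with `ans s` the planted answer (e.g. `name_k(EXIT)`). -/
structure WhiteBlackPair where
  /-- law of the published code on seed `s` -/
  code : List Bool → PMF (List Bool)
  /-- the black box of seed `s` -/
  orc : List Bool → Oracle
  /-- the planted answer of seed `s` -/
  ans : List Bool → List Bool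

/-- White-box success of a PPT `A` on `W` at seed length `n`: `E_{s ∈ {0,1}ⁿ} E_{c ∼ code s}
Pr[A(1ⁿ, c) outputs a string with prefix ans s]`. -/
def wbSucc (W : WhiteBlackPair) (A : RandAlg (List Bool) (List Bool)) (n : ℕ) : ℝ :=
  uniformAvg n fun s => ((W.code s).bind fun c =>
    A.outputPMF id (boolPair (unaryEncodeNat n) c)).toOuterMeasure {y | W.ans s <+: y} |>.toReal

/-- One-bit white-box ACCEPTANCE probability of the Boolean PPT `A` on `(1ⁿ, i, code s)`, where
`i ≤ poly(n)` is a benign public index (e.g. "which answer bit"), given to adversary and simulator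
alike. -/
def wbAcc (W : WhiteBlackPair) (A : RandAlg (List Bool) Bool) (n i : ℕ) (s : List Bool) : ℝ :=
  (((W.code s).bind fun c =>
    A.outputPMF id (boolPair (boolPair (unaryEncodeNat n) (encodeNat i)) c)).toOuterMeasure
      {b | b = true}).toReal

/-- One-bit black-box acceptance probability of an oracle simulator `S` (C4a
`OracleAdversary Bool`, run on `(1ⁿ, i)` with oracle `orc s`). -/
def bbAcc (W : WhiteBlackPair) (S : OracleAdversary Bool) (n i : ℕ) (s : List Bool) : ℝ :=
  ((S.outputPMF (W.orc s) (boolPair (unaryEncodeNat n) (encodeNat i))).toOuterMeasure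
    {o | o = some true}).toReal

/-- Black-box success of an oracle machine with string output at finding `ans s`. -/
def bbSucc (W : WhiteBlackPair) (S : OracleAdversary (List Bool)) (n : ℕ) : ℝ :=
  uniformAvg n fun s => ((S.outputPMF (W.orc s) (unaryEncodeNat n)).toOuterMeasure
    {o | ∃ y, o = some y ∧ W.ans s <+: y}).toReal

/-- `ClassicalPredVBB W`: predicate virtual-black-box security AGAINST CLASSICAL PPT ONLY
(Barak et al., Def. 2.2, predicate/acceptance form, averaged over the seed in `L¹`), for the
seed-indexed family `W`: for every Boolean PPT `A` there is a PPT oracle SIMULATOR `S` such that,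
for every polynomial index bound `B`, `E_{s ∈ {0,1}ⁿ} |Pr[A(1ⁿ,i,code s)=1] - Pr[S^{orc s}(1ⁿ,i)=1]|`
is bounded by ONE superpolynomially decaying `ε(n)` uniformly in `i ≤ B(n)`. (`L¹`-averaging makes
the definition predicate-free: `sup_π |Pr[A = π s] - Pr[S = π s]|` averaged over `s` is exactly this
quantity; the uniform index is what lets `poly(n)` bit-simulators be union-bounded.) Deliberately
PRE-QUANTUM: false for quantum adversaries whenever the black box hides something a quantum machine
reads off the code (crux-2340 barrier notes §A: any usable hypothesis must be of this kind). -/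
def ClassicalPredVBB (W : WhiteBlackPair) : Prop :=
  ∀ A : RandAlg (List Bool) Bool, IsPPT A (fun b => [b]) →
    ∃ S : OracleAdversary Bool, S.IsPPT encodingBoolBool ∧
      ∀ B : Polynomial ℕ, ∃ ε : ℕ → ℝ,
        SuperpolynomialDecay atTop (fun n : ℕ => (n : ℝ)) ε ∧
          ∀ n i, i ≤ B.eval n → uniformAvg n (fun s => |wbAcc W A n i s - bbAcc W S n i s|) ≤ ε n

/-- The black-box bound the card needs (a HORIZON/traversal bound of Childs-et-al. type, for PPT
oracle machines, with answers of length `L n` at seed length `n`): every PPT black-box solver finds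
`ans s` with probability `≤ 1/4` eventually. For glued trees this is (a uniform-machine corollary
of) `ChildsEtAl2003_thm9`. -/
def BlackBoxHard (W : WhiteBlackPair) : Prop :=
  ∀ S : OracleAdversary (List Bool), S.IsPPT (encodingList Bool) →
    ∀ᶠ n in atTop, bbSucc W S n ≤ 1 / 4

/-- **First lemma of card `predicate-vbb-bitwise` (bitwise simulation + union bound).** If the
answers have polynomial length `L`, predicate-VBB against classical adversaries plus black-box
hardness give WEAK white-box hardness with `q = 2L`: a white-box solver succeeding with
probability `> 1 - 1/(2 L n + 1)` yields ONE Boolean adversary `(code, i) ↦ bit i of the output`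
predicting each answer bit that well; its simulator, run for `i = 1..L n` on one oracle, outputs the
whole answer with probability `> 1 - L n/(2 L n + 1) - L n·ε(n) > 1/4` (union bound, `ε` uniform in
`i ≤ L n`), contradicting `BlackBoxHard`. (§A then upgrades weak to negligible.) -/
theorem weak_whitebox_of_predVBB (W : WhiteBlackPair) (L : Polynomial ℕ)
    (hL : ∀ s, (W.ans s).length = L.eval s.length) (hL1 : ∀ n, 1 ≤ L.eval n)
    (hV : ClassicalPredVBB W) (hB : BlackBoxHard W) :
    ∀ A : RandAlg (List Bool) (List Bool), IsPPT A id →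
      ∀ᶠ n in atTop, wbSucc W A n ≤ 1 - 1 / (2 * ((L.eval n : ℕ) : ℝ) + 1) := by
  sorry

/-- **Horizon lemma (glued trees, black-box, the provable crux of the card)**, in the vocabulary
of `Literature.Computability.QuantumComplexity.GluedTrees`: with `t ≤ 2^{n/6}` queries a
deterministic transcript algorithm QUERIES THE NAME OF ANY RIGHT-TREE VERTEX OF DEPTH `≤ n/2`
(not just the EXIT) only with probability `≤ 4·2^{-n/6}` over Game 1's outcome — the statement the
printed proof of Theorem 9 actually establishes (random-embedding argument, Lemmas 7–8), and the
form in which "beyond-horizon names are unpredictable" is used by bitwise simulation. -/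
def GluedTreesHorizon : Prop :=
  ∀ (n : ℕ) {β : Type} (M : OracleAlg β) (x : List Bool) (t : ℕ),
    (t : ℝ) ≤ (2 : ℝ) ^ ((n : ℝ) / 6) →
      ((Finset.univ.filter fun ω : GluedTrees.Outcome n =>
          ∃ v : GluedTrees.Vertex n, v.1 = true ∧ 2 * (v.2.1 : ℕ) ≤ n ∧
            List.ofFn (ω.2.1 v) ∈ M.queries (GluedTrees.strOracle ω.1 ω.2.1) t x).card : ℝ)
        / Fintype.card (GluedTrees.Outcome n) ≤ 4 * (2 : ℝ) ^ (-((n : ℝ) / 6))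

/-- The horizon lemma implies Theorem 9 as typed (EXIT is the right-tree vertex of depth `0`). -/
theorem thm9_of_horizon (h : GluedTreesHorizon) : ChildsEtAl2003_thm9 := by
  intro n β M x t ht
  refine le_trans ?_ (h n M x t ht)
  unfold GluedTrees.findProb
  refine div_le_div_of_nonneg_right ?_ (Nat.cast_nonneg _)
  refine Nat.cast_le.mpr (Finset.card_le_card fun ω hω => ?_)
  simp only [Finset.mem_filter, Finset.mem_univ, true_and] at hω ⊢
  exact ⟨GluedTrees.exit n, rfl, by simp [GluedTrees.exit], by simpa [GluedTrees.FindsExit] using hω⟩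

end Summit.QuantumAdvantage.QuantumAdvantage.Cruxes.WbwThesis.Sketch

end
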